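import Mathlib
import Summits.MatrixMultiplication.MatrixMultiplication.Theses.LevelGradedCohnUmans
import Summits.MatrixMultiplication.MatrixMultiplication.Theorems.SnLevelDesigns.Negative.DimensionWalls

/-!
# `SnLevelDesigns` (stmt-MatrixMultiplication-7613), line `garnir-annihilator`:
# M2 `stub_middleIdentityTest` — the middle difference set passes the identity test

Crux `Summit.MatrixMultiplication.MatrixMultiplication.Theses.LevelGradedCohnUmans.SnLevelDesigns`;
skeleton `Cruxes/SnLevelDesigns/Lines/garnir_annihilator.lean` (lead c3 reshape 6, stub M2).

CORRECTED SIGNATURE: the stub as registered (without `Y.Nonempty`) is false in the corner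
`n = 0, k ≥ 1, Y = ∅, X = Z = {1}` (the separation hypothesis is vacuous, `[k] → [0]` is empty so
`ev_1 = 0 ∈ ⊥ = span ∅`).  This file proves the statement with the extra hypothesis `Y.Nonempty →`
inserted right after `Z.Nonempty →` (nothing else changed), under the registered name.

If `(X, Y, Z)` is `k`-token separated and `X, Y, Z` are non-empty, then
`ev_1 ∉ span{ev_{y y'⁻¹} : y ≠ y' ∈ Y}` where `ev_g : c ↦ Σ_p c p (g ∘ p)` (`ev_1 c = Σ_p c p p`).
Proof: take `x₀ ∈ X`, `y₀ ∈ Y`, `z₀ ∈ Z` and the separator `c` of the target `(x₀, z₀)`; the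
re-indexed table `c' p q := c (z₀⁻¹ ∘ p) (x₀⁻¹ ∘ q)` has `ev_g c' = ev_{x₀⁻¹ g z₀} c` (two-sided
translation invariance, `Negative.tokenFn_translate`), hence `ev_1 c' = 1` (the target quadruple
`(x₀, y₀, y₀, z₀)`) and `ev_{yy'⁻¹} c' = 0` for `y ≠ y'` (the garbage `(x₀, y, y', z₀)`); evaluation
at `c'` is linear, so its kernel contains the span but not `ev_1`.
-/

set_option linter.dupNamespace false

namespace Summit.MatrixMultiplication.MatrixMultiplication.Theorems.SnLevelDesigns

open scoped BigOperators

/-- Point-evaluation separation: if every member of `s` vanishes at the point `i` but `v` does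
not, then `v` is not in the `ℂ`-span of `s` (evaluation at `i` is the linear map `LinearMap.proj i`,
whose kernel contains `span s`). -/
private theorem not_mem_span_of_eval_ne_zero {ι : Type*} (s : Set (ι → ℂ)) (v : ι → ℂ) (i : ι)
    (hs : ∀ f ∈ s, f i = 0) (hv : v i ≠ 0) : v ∉ Submodule.span ℂ s := by
  intro hmem
  have hle : Submodule.span ℂ s ≤ LinearMap.ker (LinearMap.proj (R := ℂ) (φ := fun _ : ι => ℂ) i) :=
    Submodule.span_le.mpr fun f hf => by
      simpa only [SetLike.mem_coe, LinearMap.mem_ker, LinearMap.proj_apply] using hs f hf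
  exact hv (by simpa only [LinearMap.mem_ker, LinearMap.proj_apply] using hle hmem)

/-- Registered stub M2 `stub_middleIdentityTest` (lead c3 reshape 6), with the corrected
signature (`Y.Nonempty →` added after `Z.Nonempty →`): for a `k`-token separated triple with
`X, Y, Z` non-empty, the identity-evaluation functional `c ↦ Σ_p c p p` is not in the span of the
evaluations `c ↦ Σ_p c p ((y y'⁻¹) ∘ p)` at the non-trivial middle differences `y ≠ y' ∈ Y`. -/
theorem stub_middleIdentityTest :
    ∀ (n k : ℕ) (X Y Z : Finset (Equiv.Perm (Fin n))), X.Nonempty → Z.Nonempty → Y.Nonempty →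
      (∀ x₀ ∈ X, ∀ z₀ ∈ Z, ∃ c : (Fin k → Fin n) → (Fin k → Fin n) → ℂ,
          ∀ x ∈ X, ∀ y ∈ Y, ∀ y' ∈ Y, ∀ z ∈ Z,
            (∑ p : Fin k → Fin n, c p (⇑(x⁻¹ * y * y'⁻¹ * z) ∘ p)) = if x = x₀ ∧ y = y' ∧ z = z₀ then 1 else 0) →
        (fun c : (Fin k → Fin n) → (Fin k → Fin n) → ℂ => ∑ p : Fin k → Fin n, c p p) ∉
          Submodule.span ℂ
            ((fun g : Equiv.Perm (Fin n) =>
                fun c : (Fin k → Fin n) → (Fin k → Fin n) → ℂ => ∑ p : Fin k → Fin n, c p (⇑g ∘ p)) ''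
              {g | ∃ y ∈ Y, ∃ y' ∈ Y, y ≠ y' ∧ g = y * y'⁻¹}) := by
  intro n k X Y Z hX hZ hY hsep
  obtain ⟨x₀, hx₀⟩ := hX
  obtain ⟨z₀, hz₀⟩ := hZ
  obtain ⟨y₀, hy₀⟩ := hY
  obtain ⟨c, hc⟩ := hsep x₀ hx₀ z₀ hz₀
  -- the re-indexed table `c' p q = c (z₀⁻¹ ∘ p) (x₀⁻¹ ∘ q)`: `ev_g c' = ev_{x₀⁻¹ g z₀} c`
  obtain ⟨c', hkey⟩ : ∃ c' : (Fin k → Fin n) → (Fin k → Fin n) → ℂ, ∀ g : Equiv.Perm (Fin n),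
      (∑ p : Fin k → Fin n, c' p (⇑g ∘ p)) = ∑ p : Fin k → Fin n, c p (⇑(x₀⁻¹ * g * z₀) ∘ p) :=
    ⟨fun p q => c (⇑z₀⁻¹ ∘ p) (⇑x₀⁻¹ ∘ q), fun g => (Negative.tokenFn_translate c x₀⁻¹ z₀ g).symm⟩
  -- value `1` at the identity: the target quadruple `(x₀, y₀, y₀, z₀)`
  have h1 : (∑ p : Fin k → Fin n, c' p p) = 1 := by
    have e1 := hkey 1
    have e2 := hc x₀ hx₀ y₀ hy₀ y₀ hy₀ z₀ hz₀
    rw [mul_inv_cancel_right] at e2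
    rw [mul_one] at e1
    simp only [Equiv.Perm.coe_one, Function.id_comp] at e1
    rw [e1, e2]
    simp
  -- value `0` at every non-trivial middle difference: the garbage quadruple `(x₀, y, y', z₀)`
  have h0 : ∀ g ∈ {g : Equiv.Perm (Fin n) | ∃ y ∈ Y, ∃ y' ∈ Y, y ≠ y' ∧ g = y * y'⁻¹},
      (∑ p : Fin k → Fin n, c' p (⇑g ∘ p)) = 0 := by
    rintro g ⟨y, hy, y', hy', hne, rfl⟩
    rw [hkey, ← mul_assoc x₀⁻¹ y y'⁻¹, hc x₀ hx₀ y hy y' hy' z₀ hz₀]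
    simp [hne]
  -- evaluation at `c'` kills the span but not `ev_1`
  refine not_mem_span_of_eval_ne_zero _ _ c' ?_ (by rw [h1]; exact one_ne_zero)
  rintro f ⟨g, hg, rfl⟩
  exact h0 g hg

end Summit.MatrixMultiplication.MatrixMultiplication.Theorems.SnLevelDesigns
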